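import Summits.ValiantsHypothesis.ValiantsHypothesis.Theorems.LangWeilTransferTameResolutionSizedModels
import Summits.ValiantsHypothesis.ValiantsHypothesis.Theorems.LangWeilTransferTameResolutionOfCongruences

/-!
# LangWeilTransfer — `TameResolution` (stmt-ValiantsHypothesis-6378) and the crux `TameTransfer`
# (stmt-ValiantsHypothesis-6373, THEOREM T) PROVED

Route `LangWeilTransfer` of `ValiantsHypothesis`.

* `tameResolution_proof : TameResolution` — every minimal prime of the `ℚ`-ideal of an integer system
  of degree `≤ d`, weight `≤ w` in `m` unknowns has an integer hypersurface model with constant leading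
  coefficient, the component-count inequality and the point condition over `ℚ̄`, degrees
  `≤ (d+2)^(a(m+1))`, `log₂`-weights `≤ (d+2)^(a(m+1)) (log₂ w + log₂ t + 2)^a`, `a = 512`:
  `tameResolution_of_congruenceModels` (val-width-6373-p2 g0) applied to `congruenceModels_holds`
  (…TameResolutionSizedModels: the Noether-free quantitative Kronecker parametrisation —
  coordinate transcendence basis, val-lit-p6 g9's eliminant pipeline without Noether position,
  `integralNormalization`, val-lit-p6 g9's size chain, envelope).
* `tameTransfer_proof : TameTransfer` — THEOREM T (the GRH-free arithmetic core of Bürgisser 2000,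
  Thm 4.1, in the tree's currency): there is `a` such that every integer system
  `S : Fin t → ℤ[Y_1..Y_m]` of degree `≤ d` and weight `≤ w` whose `ℚ`-ideal has a minimal prime
  with at most `B` geometric components above it has a solution over `GaloisField p r` for some
  prime `p > 2^T` and `r ≥ 1` with `p^r ≤ 2^((B + T + m + log d + log log w + log t + 2)^a)`:
  `tameTransfer_of_goodReduction_of_tameResolution` (val-lit-p6 g6; TransferGlue, LangWeilBound,
  ScalarRestriction landed) applied to `goodReduction_proof` (val-lit-p6 g8) and
  `tameResolution_proof`.

Honest framing: both are unconditional theorems of effective arithmetic; the route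
`LangWeilTransfer` to `ValiantsHypothesis` remains CONDITIONAL on its open cruxes
(ShatteringExclusion / UniversalTameness) and on P^#P ⊄ P/poly. VP ≠ VNP is NOT proved here and
these theorems alone do not move it.
-/

noncomputable section

-- the summit and the problem share the name `ValiantsHypothesis` (D-0017 single-conjunct layout)
set_option linter.dupNamespace false

namespace Summit.ValiantsHypothesis.ValiantsHypothesis.Theorems.LangWeilTransfer

open Summit.ValiantsHypothesis.ValiantsHypothesis.Theses.LangWeilTransfer

/-- **`TameResolution`** (stmt-ValiantsHypothesis-6378): Kronecker parametrisation of every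
`ℚ`-component of an integer system with single-exponential degree and height (`a = 512`). -/
theorem tameResolution_proof : TameResolution :=
  tameResolution_of_congruenceModels congruenceModels_holds

/-- **Theorem T** (`TameTransfer`, stmt-ValiantsHypothesis-6373): tame integer systems have
solutions over finite fields of single-exponentially bounded size. -/
theorem tameTransfer_proof : TameTransfer :=
  tameTransfer_of_goodReduction_of_tameResolution goodReduction_proof tameResolution_proof

end Summit.ValiantsHypothesis.ValiantsHypothesis.Theorems.LangWeilTransfer

end
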